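import Summits.Ventures.CertifiedManyBodySolver.Rows.CARPolyWindowGramContractPairs
import Summits.Ventures.CertifiedManyBodySolver.Rows.KernelPosTree
import HarnessLib

/-!
# The contracted Gram BY GROUPS with an `O(log W)` word table: one generator per Gram group (no per-pair slice spine), tree-backed
# table reads (÷100 kernel steps), and the three table facts CHUNKED into one `decide` per group + one total

HONEST FRAMING: Lean plumbing towards «tier P» (cell hubbard-obs), the answer of record to hubbard-cov-la214-box-1 g3's DATA «KERNEL-COST PROBE
OF THE GRAM-TABLE CHECKS ON REAL Rm2 DATA» (HOME/STATUS 2026-08-29T00:34:47Z: positional reads `words.getD b` cost ≈ 44 µs × b in the kernel and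
the whole-table checks extrapolate to 2.5–3.5 kernel-h per certificate, tripping the memory guard above ≈ 2 000 pairs per declaration) and
to a second, unmeasured cost of the same kind: the closer's `slices.getD i []` on `groupSlices (… gramContractSlices … …) ns` walks the
PER-PAIR slice spine (≈ 7·10⁵ cells at Rm2) before every late step. Here:
(§1) TREE-BACKED READS `polyOfT / membOfT / inCopyT / rowOfT / interKsT / pairsOfT / coefSumT / gramContractT / rangeBT D words …` — the
table `words` stays the plain positional list of `Rows/CARPolyWindowGramContract.lean` (exporter format UNCHANGED); the kernel builds
`PTree.build D words` once per declaration and reads through it; every twin EQUALS its list original (`…T_eq`, from `PTree.lookup_build`),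
so all landed theorems apply verbatim;
(§2) GROUPED SLICES `gramGroupsT D K words Qs = Qs.map (gramGroupT D K words)` — one contracted list per GROUP partner table `Qg`
(`Qs : List (List (ℕ × List ℕ))`, the exporter's groups), `flatten_gramGroupsT : (gramGroupsT …).flatten = gramContract K words (pairsOf words
Qs.flatten)` — so the Gram part of `residTGslices[Near]` has as many cells as groups (≈ 10²), not pairs (≈ 10⁶);
(§3) CHUNKED FACTS `GramGroupsOK D words Kc W Qs cs`: per group ONE Boolean (`groupOKB`: range check ∧ keys nonempty ∧ keys of this group
followed by the next group's strictly increase ∧ incidence count = the exporter's numeral `cs[g]`), plus `words.length = W`, `cs.length =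
Qs.length` and ONE total `cs.sum = Σ_k n_k²` with `n_k` counted by a direct pass over the table (`nkD`, = `(wordsIn words k).length`); and
**`termOp_flatten_gramGroupsT`**: these facts ⇒ the grouped slices denote the PSD two-level `gramForm` of `copyBlocks words Kc` (through
`termOp_gramContract`: validity from the range checks, global sortedness from consecutive-pair sortedness with nonempty groups, the count from
the per-group numerals) — i.e. exactly the `hTG` hypothesis of the abstract-Gram closers of record (`…GNear` / `…GAuto`) with `TGs :=
gramGroupsT D K words Qs`, `Λm := gramTBCoef K (copyBlocks words Kc)`, `O := gramTBOp d (copyBlocks words Kc)`. Instance obligations: `hW`,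
`len`, `total` by `decide`, `group g` by `Fin` match with one `decide +kernel` per group. No certificate, no number of record; nothing
discharged; CONTROL/CALIBRATION context (wording (xx1)); no summit statement is proved by this file. Seat hubbard-obs-p2 (STIFFNESS),
`prover-hubbard-obs-p2-g24-0`, zero compute.

References: X. Han, arXiv:2006.06002 §2 eq. (2), §3 (Gram family; symmetry-adapted blocks) [Han2020Bootstrap]; J. Wang et al., PRX 14 (2024)
031006 §III [WangEtAl2024]; C. Jansson, D. Chaykin, C. Keil, SIAM J. Numer. Anal. 46 (2008) 180 [JanssonChaykinKeil2008]; C. Okasaki, *Purely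
Functional Data Structures* (CUP 1998) §9.2 [Okasaki1998].
-/

namespace Summit.Ventures.CertifiedManyBodySolver

namespace CARPolyWindow

open Summit.Ventures.CertifiedQuantumChemistry Summit.Ventures.CertifiedQuantumChemistry.CARPoly
open Literature.MathematicalPhysics.QuantumManyBody.StateRelaxation
open Matrix
open scoped ComplexOrder BigOperators

/-! ## §1 Tree-backed reads of the word table (semantics = the positional list reads) -/

section TreeReads

variable {α : Type*}

/-- Row `a` of the word table read through the positional tree of depth `D`. [cite: Okasaki1998, §9.2] -/
def wtab (D : ℕ) (words : WordTable α) (a : ℕ) : Terms α × List (ℕ × List ℤ) :=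
  PTree.lookup D (PTree.build D words).1 words a ([], [])

/-- The tree read IS the list read. [folklore] -/
theorem wtab_eq (D : ℕ) (words : WordTable α) (a : ℕ) : wtab D words a = words.getD a ([], []) := PTree.lookup_build D words a _

/-- Tree twin of `polyOf`. [folklore] -/
def polyOfT (D : ℕ) (words : WordTable α) (a : ℕ) : Terms α := (wtab D words a).1

/-- Tree twin of `membOf`. [folklore] -/
def membOfT (D : ℕ) (words : WordTable α) (a : ℕ) : List (ℕ × List ℤ) := (wtab D words a).2

/-- `polyOfT = polyOf`. [folklore] -/
theorem polyOfT_eq (D : ℕ) (words : WordTable α) (a : ℕ) : polyOfT D words a = polyOf words a := by rw [polyOfT, wtab_eq, polyOf]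

/-- `membOfT = membOf`. [folklore] -/
theorem membOfT_eq (D : ℕ) (words : WordTable α) (a : ℕ) : membOfT D words a = membOf words a := by rw [membOfT, wtab_eq, membOf]

/-- Tree twin of `inCopy`. [folklore] -/
def inCopyT (D : ℕ) (words : WordTable α) (a k : ℕ) : Bool := (membOfT D words a).any fun e => e.1 == k

/-- `inCopyT = inCopy`. [folklore] -/
theorem inCopyT_eq (D : ℕ) (words : WordTable α) (a k : ℕ) : inCopyT D words a k = inCopy words a k := by rw [inCopyT, membOfT_eq, inCopy]

/-- Selecting the row of a found membership. [folklore] -/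
def rowSel : Option (ℕ × List ℤ) → List ℤ
  | some e => e.2
  | none => []

/-- `rowOf` through `rowSel`. [folklore] -/
theorem rowOf_eq_rowSel (words : WordTable α) (a k : ℕ) : rowOf words a k = rowSel ((membOf words a).find? fun e => e.1 == k) := by
  unfold rowOf
  split
  · rename_i e h
    rw [h, rowSel]
  · rename_i h
    rw [h, rowSel]

/-- Tree twin of `rowOf`. [folklore] -/
def rowOfT (D : ℕ) (words : WordTable α) (a k : ℕ) : List ℤ := rowSel ((membOfT D words a).find? fun e => e.1 == k)

/-- `rowOfT = rowOf`. [folklore] -/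
theorem rowOfT_eq (D : ℕ) (words : WordTable α) (a k : ℕ) : rowOfT D words a k = rowOf words a k := by
  rw [rowOfT, membOfT_eq, rowOf_eq_rowSel]

/-- Tree twin of `interKs`. [folklore] -/
def interKsT (D : ℕ) (words : WordTable α) (a b : ℕ) : List ℕ :=
  (membOfT D words a).filterMap fun e => if inCopyT D words b e.1 then some e.1 else none

/-- `interKsT = interKs`. [folklore] -/
theorem interKsT_eq (D : ℕ) (words : WordTable α) (a b : ℕ) : interKsT D words a b = interKs words a b := by
  simp only [interKsT, interKs, membOfT_eq, inCopyT_eq]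

/-- Tree twin of `pairsOf`. [cite: Han2020Bootstrap, §3] -/
def pairsOfT (D : ℕ) (words : WordTable α) (Q : List (ℕ × List ℕ)) : List (ℕ × ℕ × List ℕ) :=
  Q.flatMap fun e => e.2.map fun b => (e.1, b, interKsT D words e.1 b)

/-- `pairsOfT = pairsOf`. [folklore] -/
theorem pairsOfT_eq (D : ℕ) (words : WordTable α) (Q : List (ℕ × List ℕ)) : pairsOfT D words Q = pairsOf words Q := by
  simp only [pairsOfT, pairsOf, interKsT_eq]

/-- Tree twin of `coefSum`. [folklore] -/
def coefSumT (D : ℕ) (words : WordTable α) (a b : ℕ) (ks : List ℕ) : ℤ :=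
  (ks.map fun k => idot (rowOfT D words a k) (rowOfT D words b k)).sum

/-- `coefSumT = coefSum`. [folklore] -/
theorem coefSumT_eq (D : ℕ) (words : WordTable α) (a b : ℕ) (ks : List ℕ) : coefSumT D words a b ks = coefSum words a b ks := by
  simp only [coefSumT, coefSum, rowOfT_eq]

/-- Tree twin of `gramContract`. [cite: Han2020Bootstrap, §2 eq. (2)] [cite: WangEtAl2024, §III] -/
def gramContractT (D K : ℕ) (words : WordTable α) (P : List (ℕ × ℕ × List ℕ)) : Terms α :=
  P.flatMap fun e => scaleT ((coefSumT D words e.1 e.2.1 e.2.2 : ℚ) / 4 ^ K) (mulT (daggerT (polyOfT D words e.1)) (polyOfT D words e.2.1))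

/-- `gramContractT = gramContract`. [folklore] -/
theorem gramContractT_eq (D K : ℕ) (words : WordTable α) (P : List (ℕ × ℕ × List ℕ)) :
    gramContractT D K words P = gramContract K words P := by
  simp only [gramContractT, gramContract, coefSumT_eq, polyOfT_eq]

/-- Tree twin of `rangeB`. [folklore] -/
def rangeBT (D : ℕ) (words : WordTable α) (Kc : ℕ) (Q : List (ℕ × List ℕ)) : Bool :=
  Q.all fun e => decide (e.1 < words.length) && (e.2.all fun b => decide (b < words.length)) &&
    ((membOfT D words e.1).all fun m => decide (m.1 < Kc))

/-- `rangeBT = rangeB`. [folklore] -/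
theorem rangeBT_eq (D : ℕ) (words : WordTable α) (Kc : ℕ) (Q : List (ℕ × List ℕ)) : rangeBT D words Kc Q = rangeB words Kc Q := by
  simp only [rangeBT, rangeB, membOfT_eq]

end TreeReads

/-! ## §2 The grouped contracted slices -/

section Groups

variable {α : Type*}

/-- **One Gram GROUP**: the contracted list of the group's partner table (tree reads). [cite: Han2020Bootstrap, §2 eq. (2)] -/
def gramGroupT (D K : ℕ) (words : WordTable α) (Qg : List (ℕ × List ℕ)) : Terms α := gramContractT D K words (pairsOfT D words Qg)

/-- **The grouped slices**: one slice per group. [cite: WangEtAl2024, §III] -/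
def gramGroupsT (D K : ℕ) (words : WordTable α) (Qs : List (List (ℕ × List ℕ))) : List (Terms α) := Qs.map (gramGroupT D K words)

/-- `pairsOf` is additive in the partner table. [folklore] -/
theorem pairsOf_append (words : WordTable α) (Q Q' : List (ℕ × List ℕ)) : pairsOf words (Q ++ Q') = pairsOf words Q ++ pairsOf words Q' := by
  simp [pairsOf, List.flatMap_append]

/-- `gramContract` is additive in the pair list. [folklore] -/
theorem gramContract_append (K : ℕ) (words : WordTable α) (P P' : List (ℕ × ℕ × List ℕ)) :
    gramContract K words (P ++ P') = gramContract K words P ++ gramContract K words P' := by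
  simp [gramContract, List.flatMap_append]

/-- **The grouped slices re-assemble the contracted list of the concatenated partner tables.** [folklore] -/
theorem flatten_gramGroupsT (D K : ℕ) (words : WordTable α) :
    ∀ Qs : List (List (ℕ × List ℕ)), (gramGroupsT D K words Qs).flatten = gramContract K words (pairsOf words Qs.flatten)
  | [] => rfl
  | Qg :: Qs => by
    rw [gramGroupsT, List.map_cons, List.flatten_cons, ← gramGroupsT, flatten_gramGroupsT D K words Qs, gramGroupT, gramContractT_eq,
      pairsOfT_eq, List.flatten_cons, pairsOf_append, gramContract_append]

/-- `incid` is additive. [folklore] -/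
theorem incid_append (P P' : List (ℕ × ℕ × List ℕ)) : incid (P ++ P') = incid P ++ incid P' := by
  simp [incid, List.flatMap_append]

end Groups

/-! ## §3 The chunked table facts -/

section Chunked

variable {α : Type*}

/-- The incidence keys of one group, in order (tree reads). [folklore] -/
def keysT (D : ℕ) (words : WordTable α) (W Kc : ℕ) (Qg : List (ℕ × List ℕ)) : List ℕ :=
  (incid (pairsOfT D words Qg)).map fun t => incKey W Kc t.1 t.2.1 t.2.2

/-- The incidence keys of one group (list reads; the reference). [folklore] -/
def keysL (words : WordTable α) (W Kc : ℕ) (Qg : List (ℕ × List ℕ)) : List ℕ :=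
  (incid (pairsOf words Qg)).map fun t => incKey W Kc t.1 t.2.1 t.2.2

/-- `keysT = keysL`. [folklore] -/
theorem keysT_eq (D : ℕ) (words : WordTable α) (W Kc : ℕ) (Qg : List (ℕ × List ℕ)) : keysT D words W Kc Qg = keysL words W Kc Qg := by
  rw [keysT, pairsOfT_eq, keysL]

/-- The incidence count of one group (tree reads). [folklore] -/
def cntT (D : ℕ) (words : WordTable α) (Qg : List (ℕ × List ℕ)) : ℕ := ((pairsOfT D words Qg).map fun e => e.2.2.length).sum

/-- The incidence count of one group (list reads). [folklore] -/
def cntL (words : WordTable α) (Qg : List (ℕ × List ℕ)) : ℕ := ((pairsOf words Qg).map fun e => e.2.2.length).sum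

/-- `cntT = cntL`. [folklore] -/
theorem cntT_eq (D : ℕ) (words : WordTable α) (Qg : List (ℕ × List ℕ)) : cntT D words Qg = cntL words Qg := by rw [cntT, pairsOfT_eq, cntL]

/-- `n_k` by a DIRECT pass over the table: the number of rows listing copy `k`. [folklore] -/
def nkD (words : WordTable α) (k : ℕ) : ℕ := words.countP fun w => w.2.any fun e => e.1 == k

/-- Index-filtering a list through positional reads counts like `countP`. [folklore] -/
theorem length_filter_range_getD {γ : Type*} (d : γ) (q : γ → Bool) :
    ∀ l : List γ, ((List.range l.length).filter fun i => q (l.getD i d)).length = l.countP q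
  | [] => by simp
  | b :: l => by
    rw [List.length_cons, List.range_succ_eq_map, List.filter_cons, List.countP_cons]
    have hmap : ((List.range l.length).map Nat.succ).filter (fun i => q ((b :: l).getD i d)) =
        ((List.range l.length).filter fun i => q (l.getD i d)).map Nat.succ := by
      rw [List.filter_map]
      rfl
    cases hb : q ((b :: l).getD 0 d) with
    | true =>
      have hb' : q b = true := hb
      simp only [hb', if_true, List.length_cons, hmap, List.length_map, length_filter_range_getD d q l]
    | false =>
      have hb' : q b = false := hb
      simp only [hb', hmap, List.length_map, length_filter_range_getD d q l, Bool.false_eq_true, ite_false, Nat.add_zero]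

/-- `nkD` IS the size of `wordsIn`. [folklore] -/
theorem nkD_eq (words : WordTable α) (k : ℕ) : nkD words k = (wordsIn words k).length := by
  rw [nkD, wordsIn, ← length_filter_range_getD ([], []) (fun w : Terms α × List (ℕ × List ℤ) => w.2.any fun e => e.1 == k) words]
  rfl

/-- **The per-group Boolean**: range check ∧ keys nonempty ∧ (keys of this group ++ keys of the next) strictly increase ∧ count = numeral.
[folklore] -/
def groupOKB (D : ℕ) (words : WordTable α) (Kc W : ℕ) (Qg Qnext : List (ℕ × List ℕ)) (c : ℕ) : Bool :=
  rangeBT D words Kc Qg && decide (keysT D words W Kc Qg ≠ []) && incrB (keysT D words W Kc Qg ++ keysT D words W Kc Qnext) &&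
    decide (cntT D words Qg = c)

/-- **The chunked table facts of a grouped contracted Gram** (instance: `hW`, `len`, `total` by `decide`; `group` by `Fin` match, one
`decide +kernel` per group). [cite: JanssonChaykinKeil2008, §3] -/
structure GramGroupsOK (D : ℕ) (words : WordTable α) (Kc W : ℕ) (Qs : List (List (ℕ × List ℕ))) (cs : List ℕ) : Prop where
  /-- the table has `W` rows -/
  hW : words.length = W
  /-- one numeral per group -/
  len : cs.length = Qs.length
  /-- the per-group Boolean, against the NEXT group (the empty table after the last) -/
  group : ∀ g : Fin Qs.length, groupOKB D words Kc W (Qs.get g) (Qs.getD (g.val + 1) []) (cs.getD g.val 0) = true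
  /-- the numerals add up to `Σ_k n_k²` -/
  total : cs.sum = ((List.range Kc).map fun k => nkD words k * nkD words k).sum

/-- `rangeB` of a concatenation from its parts. [folklore] -/
theorem rangeB_flatten (words : WordTable α) (Kc : ℕ) : ∀ Qs : List (List (ℕ × List ℕ)),
    (∀ Qg ∈ Qs, rangeB words Kc Qg = true) → rangeB words Kc Qs.flatten = true
  | [], _ => by simp [rangeB]
  | Qg :: Qs, h => by
    have h1 := h Qg (List.mem_cons_self)
    have h2 := rangeB_flatten words Kc Qs fun Q hQ => h Q (List.mem_cons_of_mem _ hQ)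
    rw [rangeB] at h1 h2 ⊢
    rw [List.flatten_cons, List.all_append, h1, h2, Bool.true_and]

/-- Consecutive-pair sortedness with nonempty chunks gives global sortedness. [folklore] -/
theorem pairwise_flatten_of_links : ∀ Ks : List (List ℕ),
    (∀ i (hi : i < Ks.length), Ks[i] ≠ [] ∧ (Ks[i] ++ Ks.getD (i + 1) []).Pairwise (· < ·)) → Ks.flatten.Pairwise (· < ·)
  | [], _ => List.Pairwise.nil
  | A :: Ks, h => by
    have h0 := h 0 (by simp)
    simp only [List.getElem_cons_zero, List.getD_cons_succ] at h0
    have hKs : ∀ i (hi : i < Ks.length), Ks[i] ≠ [] ∧ (Ks[i] ++ Ks.getD (i + 1) []).Pairwise (· < ·) := by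
      intro i hi
      have h' := h (i + 1) (by simpa using hi)
      simpa using h'
    have ih := pairwise_flatten_of_links Ks hKs
    rw [List.flatten_cons, List.pairwise_append]
    refine ⟨(List.pairwise_append.1 h0.2).1, ih, ?_⟩
    intro a ha c hc
    cases Ks with
    | nil => simp at hc
    | cons B Ks' =>
      simp only [List.getD_cons_zero] at h0
      have hAB := (List.pairwise_append.1 h0.2).2.2
      have hB : B ≠ [] := (hKs 0 (by simp)).1
      rw [List.flatten_cons, List.mem_append] at hc
      rcases hc with hc | hc
      · exact hAB a ha c hc
      · obtain ⟨b₀, hb₀⟩ := List.exists_mem_of_ne_nil B hB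
        have hflat : (B ++ Ks'.flatten).Pairwise (· < ·) := by rw [← List.flatten_cons]; exact ih
        exact lt_trans (hAB a ha b₀ hb₀) ((List.pairwise_append.1 hflat).2.2 b₀ hb₀ c hc)

/-- Per-position numerals sum like the per-group counts. [folklore] -/
theorem sum_map_eq_sum_of_getD {γ : Type*} (f : γ → ℕ) : ∀ (Qs : List γ) (cs : List ℕ), cs.length = Qs.length →
    (∀ i (hi : i < Qs.length), f Qs[i] = cs.getD i 0) → (Qs.map f).sum = cs.sum
  | [], [], _, _ => rfl
  | [], _ :: _, h, _ => by simp at h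
  | _ :: _, [], h, _ => by simp at h
  | Q :: Qs, c :: cs, hl, h => by
    have h0 := h 0 (by simp)
    simp only [List.getElem_cons_zero, List.getD_cons_zero] at h0
    have hrest : ∀ i (hi : i < Qs.length), f Qs[i] = cs.getD i 0 := by
      intro i hi
      have h' := h (i + 1) (by simpa using hi)
      rw [List.getElem_cons_succ, List.getD_cons_succ] at h'
      exact h'
    rw [List.map_cons, List.sum_cons, List.sum_cons, h0, sum_map_eq_sum_of_getD f Qs cs (by simpa using hl) hrest]

/-- The keys of a concatenation are the concatenated keys. [folklore] -/
theorem keys_flatten (words : WordTable α) (W Kc : ℕ) : ∀ Qs : List (List (ℕ × List ℕ)),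
    ((incid (pairsOf words Qs.flatten)).map fun t => incKey W Kc t.1 t.2.1 t.2.2) = (Qs.map (keysL words W Kc)).flatten
  | [] => rfl
  | Qg :: Qs => by
    rw [List.flatten_cons, pairsOf_append, incid_append, List.map_append, keys_flatten words W Kc Qs, List.map_cons, List.flatten_cons, keysL]

/-- The counts of a concatenation are the summed counts. [folklore] -/
theorem cnt_flatten (words : WordTable α) : ∀ Qs : List (List (ℕ × List ℕ)),
    ((pairsOf words Qs.flatten).map fun e => e.2.2.length).sum = (Qs.map (cntL words)).sum
  | [] => rfl
  | Qg :: Qs => by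
    rw [List.flatten_cons, pairsOf_append, List.map_append, List.sum_append, cnt_flatten words Qs, List.map_cons, List.sum_cons, cntL]

/-- Reading the per-group Boolean. [folklore] -/
theorem groupOKB_read {D : ℕ} {words : WordTable α} {Kc W : ℕ} {Qg Qnext : List (ℕ × List ℕ)} {c : ℕ}
    (h : groupOKB D words Kc W Qg Qnext c = true) :
    rangeB words Kc Qg = true ∧ keysL words W Kc Qg ≠ [] ∧ (keysL words W Kc Qg ++ keysL words W Kc Qnext).Pairwise (· < ·) ∧
      cntL words Qg = c := by
  simp only [groupOKB, Bool.and_eq_true, decide_eq_true_eq, rangeBT_eq, keysT_eq, cntT_eq] at h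
  exact ⟨h.1.1.1, h.1.1.2, pairwise_of_incrB _ h.1.2, h.2⟩

/-- `(Qs.map f).getD i []` reads through `f` when `f [] = []`. [folklore] -/
theorem getD_map_nil {γ δ : Type*} (f : List γ → List δ) (hf : f [] = []) : ∀ (Qs : List (List γ)) (i : ℕ),
    (Qs.map f).getD i [] = f (Qs.getD i [])
  | [], i => by simp [hf]
  | Q :: Qs, 0 => by simp
  | Q :: Qs, i + 1 => by rw [List.map_cons, List.getD_cons_succ, List.getD_cons_succ, getD_map_nil f hf Qs i]

variable {ι : Type*} [LinearOrder ι] [Fintype ι]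

/-- **THE GROUPED CONTRACTION THEOREM: the chunked facts ⇒ the grouped slices denote the PSD two-level `gramForm` of the per-copy blocks**
— the `hTG` hypothesis of the abstract-Gram closers with `TGs := gramGroupsT D K words Qs`. [cite: Han2020Bootstrap, §2 eq. (2)]
[cite: WangEtAl2024, §III] [cite: JanssonChaykinKeil2008, §3] -/
theorem termOp_flatten_gramGroupsT {d : α → ι} (D K : ℕ) (words : WordTable α) (Kc W : ℕ) (Qs : List (List (ℕ × List ℕ))) (cs : List ℕ)
    (h : GramGroupsOK D words Kc W Qs cs) :
    termOp d (gramGroupsT D K words Qs).flatten = gramForm (gramTBCoef K (copyBlocks words Kc)) (gramTBOp d (copyBlocks words Kc)) := by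
  have hread : ∀ i (hi : i < Qs.length), rangeB words Kc Qs[i] = true ∧ keysL words W Kc Qs[i] ≠ [] ∧
      (keysL words W Kc Qs[i] ++ keysL words W Kc (Qs.getD (i + 1) [])).Pairwise (· < ·) ∧ cntL words Qs[i] = cs.getD i 0 := by
    intro i hi
    have hg := h.group ⟨i, hi⟩
    rw [List.get_eq_getElem] at hg
    exact groupOKB_read hg
  -- validity
  have hv : ValidP words Kc (pairsOf words Qs.flatten) := by
    refine validP_pairsOf words Kc _ (rangeB_flatten words Kc Qs fun Qg hQg => ?_)
    obtain ⟨i, hi, rfl⟩ := List.getElem_of_mem hQg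
    exact (hread i hi).1
  -- sortedness
  have hs : SortedP words.length Kc (pairsOf words Qs.flatten) := by
    rw [SortedP, h.hW, keys_flatten]
    refine pairwise_flatten_of_links _ fun i hi => ?_
    rw [List.length_map] at hi
    rw [List.getElem_map, getD_map_nil (keysL words W Kc) rfl]
    exact ⟨(hread i hi).2.1, (hread i hi).2.2.1⟩
  -- count
  have hc : CountP words Kc (pairsOf words Qs.flatten) := by
    rw [CountP, cnt_flatten, sum_map_eq_sum_of_getD (cntL words) Qs cs h.len fun i hi => (hread i hi).2.2.2, h.total]
    simp only [nkD_eq]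
  rw [flatten_gramGroupsT, termOp_gramContract K words Kc _ hv hs hc, termOp_gramTB_eq_gramForm]

end Chunked

end CARPolyWindow

end Summit.Ventures.CertifiedManyBodySolver
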